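import Literature.MathematicalPhysics.QuantumFieldTheory.Balaban1983to89.B9SectBQLawsL2OfKernelY

/-!
# Balaban [B9], (3.80)–(3.81) p. 406 for a GENERIC averaging pair `(𝔮, 𝔮s)` — the displayed VARIATION laws `hQ80 ∕ hQL280` of the K2-G frames REDUCED TO KERNEL
# DATA: the (3.80) letters `F₂QC ∕ F₂sQC ∕ F₂QC2 ∕ F₂sQC2` at a (base `U`, multiplier `a`) pair ARE the coded letters `QbQC ∕ QsbQC ∕ QbQC2 ∕ QsbQC2` of the
# DIFFERENCE LETTERS `V ↦ 𝔮(e^{iηa}·V) − 𝔮(V)`, `V ↦ 𝔮s(e^{iηa}·V) − 𝔮s(V)`, so dag-n06-c's kernel packagings (`B9SectBQLawsOfKernelY`, `B9SectBQLawsL2OfKernelY`) apply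
# verbatim to a row ∕ column kernel of the differences (CASCADE-K piece «K2-G», the packaging half of «P-Q80-knit»)

T. Bałaban, *Propagators for lattice gauge theories in a background field*, Commun. Math. Phys. **99** (1985) 389–434 [`Balaban1985BackgroundPropagators`, "B9"];
[4] = [`Balaban1984PropagatorsII`]; [B8] = [`Balaban1985Averaging`].

statement-level skeleton of published theorems with citation tags; proofs where landed; nothing here is a claim about the Yang–Mills mass gap

THE PRINTED LOCUS.  (3.80) p. 406: *«Q_j(U′U) = Q_j(U) + F_{2,j}(A)»*, (3.81): *«|F_{2,j}(A)A′| ≦ … ≦ O(1)α₁Q″_j|A′| on Λ_j»*, and *«We have a similar expansion for Q*_j(U′U),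
i.e. Q*_j(U′U) = Q*_j(U) + F*_{2,j}(A), and F*_{2,j}(A) satisfies (3.81). (Let us notice that for complex configurations A the operator F*_{2,j}(A) is not the adjoint
of F_{2,j}(A).)»* — both variations are block-local operators with kernels of mass `O(1)·α₁`; the K2-G constructors display exactly this as `hQ80` (block-sup,
`B9SectBGFramesSelQY.gFrame₅CodedOnSelQ`) and `hQL280` (block-ℓ², `B9SectBL2GFrameSelQY.l2GFrame₈CodedOnSelQ`), inhabited at the straight pair by
`B9SectBQLawsStraightY.hQ80_straight ∕ hQL280_straight`.

WHY THIS FILE (cell `pub-ymgap`, node N06, seat `pub-ymgap-dag-n06-l` gen 39; programme «P-Q80-knit» file 3a — dag-lead WORDS 490∕498: `hQ80 ∕ hQL280` at the knit pair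
are this seat's).  The knit supplier (`B9Eq380QknitVariationY.norm_QknitY_mulY_sub_apply_le`, file 2) is a ROW KERNEL `O(1)·α₁·boxK` for the difference
`Q(e^{iηa}U) − Q(U)`.  THIS FILE is the pair-generic bookkeeping turning such kernel data into the binders: §1 ★ `F₂QC_eq_QbQC_diff` ∕ `F₂sQC_eq_QsbQC_diff` ∕
`F₂QC2_eq_QbQC2_diff` ∕ `F₂sQC2_eq_QsbQC2_diff` (linearity of `conj b ∘ bondOpCoordsY ∘ (ext∘·)` etc. in the letter); §2 ★★ `hasMajorant_F₂QC_of_rowKernel`,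
`hasMajorant_F₂sQC_of_colKernel'` (block-restricted volume-weighted column mass), `hasL2Majorant_F₂QC2_of_rowKernel`, `hasL2Majorant_F₂sQC2_of_colKernel` — dag-n06-c's
four packagings at the difference letters; §3 ★★ `hQ80_of_kernels` ∕ `hQL280_of_kernels` — the member-level packaging in EXACTLY the binder shapes `hQ80 ∕ hQL280` of
`B9SectBStepUParGQOfMembers.sectBStepUParGQ_of_members`: kernel data for the two differences on the instance's class `C37 j β′ U a` with masses `≦ C·β′` give the
binders with `cF := (M₂Σ‖b_j‖)·C·e^{r}`, `cF2 := (√|ι|·M₂Σ‖b_j‖)·C·e^{r}`; §4 ★ `endBlock_small_of_cplx337` — THE LEVEL WINDOW discharging the end-block smallness law the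
knit supplier consumes from r06's NESTED class (3.37) (`Cplx337 … (levV1 i) α₁ a`): on the two end blocks of an index bond of level `j` every fine site has level `≧ j − 1`
([4] (2.2)–(2.4), r03's `B6Ineq2142KLevelV1.lev_ends_bounds`), so `Lʲη·‖a_μ(x)‖ ≦ L·α₁` — print's «|A| < α₁(Lʲη)⁻¹ on Bʲ(Λ_j)» (p. 406) read honestly across the
layer boundary (the constant «depending on d and L»).

HONEST SCOPE.  Finite-dimensional bookkeeping over DEFINED objects; the kernel bounds are HYPOTHESES (supplied at the knit pair by file 3b from file 2); nothing of [B9]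
asserted; count-neutral; N06 NOT discharged; K1⁹ NOT closed; nothing continuum ∕ OS ∕ mass-gap ∕ Clay — the Yang–Mills mass gap is NOT proved here.  0 `def`, 0 `sorry`,
no `instance`, no `notation`.  `--supports stmt-QuantumFields-27364`.

RELATED IN THE TREE, NOT DUPLICATED (USED BY NAME): `B9SectBQLawsOfKernelY.hasMajorant_QbQC_of_rowKernel`, `B9SectBQLawsL2OfKernelY.hasMajorant_QsbQC_of_colKernel' ∕
hasL2Majorant_QbQC2_of_rowKernel ∕ hasL2Majorant_QsbQC2_of_colKernel`, `B9SectBGWordDeltaAQY` (`QbQC QsbQC F₂QC F₂sQC`), `B9SectBQLettersL2QY` (`QbQC2 QsbQC2 F₂QC2 F₂sQC2`),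
`B9Eq352DivFormLetters.conj_sub`; the straight instance `B9SectBQLawsStraightY` (different letters, NOT re-proved).
-/

noncomputable section

namespace Literature.MathematicalPhysics.QuantumFieldTheory.Balaban1983to89.B9SectBQVarLawsOfKernelY

open Literature.MathematicalPhysics.QuantumFieldTheory.Balaban1983to89
open Literature.MathematicalPhysics.QuantumFieldTheory.Balaban1983to89.Node00 (SiteY BlkY FBondY IBondY CfgY repBondY bondOpCoordsY)
open Literature.MathematicalPhysics.QuantumFieldTheory.Balaban1983to89.B6Ineq2142KLevelV1 (β)
open Literature.MathematicalPhysics.QuantumFieldTheory.Balaban1983to89.B6GlobalChartV1 (blkV1)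
open Literature.MathematicalPhysics.QuantumFieldTheory.Balaban1983to89.B6KLevelCensusIndexV1 (KIdx kGeo)
open Literature.MathematicalPhysics.QuantumFieldTheory.Balaban1983to89.B6RandomWalk (HasMajorant hasMajorant_mono)
open Literature.MathematicalPhysics.QuantumFieldTheory.Balaban1983to89.B6RandomWalkL2 (HasL2Majorant hasL2Majorant_mono)
open Literature.MathematicalPhysics.QuantumFieldTheory.Balaban1983to89.B9Thm34Ext (toB6)
open Literature.MathematicalPhysics.QuantumFieldTheory.Balaban1983to89.B9GeoNormsKLevelV1 (geo9K)
open Literature.MathematicalPhysics.QuantumFieldTheory.Balaban1983to89.B9PinMembersKLevelV1 (MemberY geo9Y)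
open Literature.MathematicalPhysics.QuantumFieldTheory.Balaban1983to89.B9Eq352DivFormLetters (conj conj_sub)
open Literature.MathematicalPhysics.QuantumFieldTheory.Balaban1983to89.B9Eq360DeltaPrimeAY (AfldY)
open Literature.MathematicalPhysics.QuantumFieldTheory.Balaban1983to89.B9SectBGpLettersY (decY decY_base blkC)
open Literature.MathematicalPhysics.QuantumFieldTheory.Balaban1983to89.B9SectBCodedCarrier (CCfg)
open Literature.MathematicalPhysics.QuantumFieldTheory.Balaban1983to89.B9SectBGWordDeltaAY (volY)
open Literature.MathematicalPhysics.QuantumFieldTheory.Balaban1983to89.B9SectBGWordDeltaAQY (QbQY QsbVQY QbQC QsbQC F₂QC F₂sQC)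
open Literature.MathematicalPhysics.QuantumFieldTheory.Balaban1983to89.B9SectBQLettersL2QY (QbQY2 QsbQY2 QbQC2 QsbQC2 F₂QC2 F₂sQC2)
open Literature.MathematicalPhysics.QuantumFieldTheory.Balaban1983to89.B9SectBL2GReadY (indB)
open Literature.MathematicalPhysics.QuantumFieldTheory.Balaban1983to89.B9SectBQLawsOfKernelY (hasMajorant_QbQC_of_rowKernel)
open Literature.MathematicalPhysics.QuantumFieldTheory.Balaban1983to89.B9SectBQLawsL2OfKernelY (hasMajorant_QsbQC_of_colKernel' hasL2Majorant_QbQC2_of_rowKernel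
  hasL2Majorant_QsbQC2_of_colKernel)
open Literature.MathematicalPhysics.QuantumFieldTheory.Balaban1983to89.B6Ineq2142KLevelV1 (lev_ends_bounds)
open Literature.MathematicalPhysics.QuantumFieldTheory.Balaban1983to89.B6GlobalChartV1 (PV)
open Literature.MathematicalPhysics.QuantumFieldTheory.Balaban1983to89.B9GeoLemma21KLevelV1 (one_le_k geo9K_eta_pos)
open Literature.MathematicalPhysics.QuantumFieldTheory.Balaban1983to89.B9Eq3132Ineq2142Covariant (two_le_RMh)
open Literature.MathematicalPhysics.QuantumFieldTheory.Balaban1983to89.B9BackgroundsKLevelV1 (levV1 shiftsV1)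
open Literature.MathematicalPhysics.QuantumFieldTheory.Balaban1983to89.B9Eq335RegularityClasses (Cplx337 OnOmega)
open Literature.MathematicalPhysics.QuantumFieldTheory.Balaban1983to89.LatticeNorms (scaleLen)
open Literature.MathematicalPhysics.QuantumFieldTheory.Balaban1983to89.B5Eq118OneStroke (iterBlockOf)

variable {d ℓ : ℕ} {hd : 1 ≤ d + 1} {hL : Odd (ℓ + 1) ∧ 1 < ℓ + 1} {b₀ b₁ : ℝ}
variable {𝔸 : Type} [NormedRing 𝔸] [NormedAlgebra ℂ 𝔸] [CompleteSpace 𝔸]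
variable {ι : Type} [Fintype ι]
variable (i : KIdx d ℓ hd hL b₀ b₁) (𝔮 : CfgY 𝔸 i → ((FBondY i → 𝔸) →ₗ[ℂ] (IBondY i → 𝔸)))
  (𝔮s : CfgY 𝔸 i → ((IBondY i → 𝔸) →ₗ[ℂ] (FBondY i → 𝔸))) (b : Module.Basis ι ℝ 𝔸) (ιB : BlkY i → IBondY i)

/-! ## §1 The (3.80) letters are the coded letters of the difference letters -/

omit [CompleteSpace 𝔸] in
/-- restriction of scalars of bond endomorphisms respects differences. [folklore] -/
private theorem restrictScalars_sub' {M : Type} [AddCommGroup M] [Module ℂ M] (f g : Module.End ℂ M) :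
    (f - g).restrictScalars ℝ = f.restrictScalars ℝ - g.restrictScalars ℝ := rfl

/-- ★ **`F₂ = Qb` OF THE DIFFERENCE LETTER**: `F₂QC 𝔮 b (base U) (mult a) = QbQC (V ↦ 𝔮(e^{iηa}V) − 𝔮(V)) b (base U)` (linearity of `ext ∘ ·`, `bondOpCoordsY`, restriction
of scalars and `conj b` in the letter). [cite: Balaban1985BackgroundPropagators, (3.80) p.406, (3.12) p.393] -/
theorem F₂QC_eq_QbQC_diff (U : CfgY 𝔸 i) (a : AfldY 𝔸 i) :
    F₂QC i 𝔮 b (.base U) (.mult a) = QbQC i (fun V => 𝔮 (decY i (.prod V a)) - 𝔮 V) b (.base U) := by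
  show QbQC i 𝔮 b (.prod U a) - QbQC i 𝔮 b (.base U) = _
  simp only [QbQC, QbQY, decY_base, LinearMap.comp_sub, map_sub, restrictScalars_sub', conj_sub]

/-- ★ **`F₂* = Qsb` OF THE DIFFERENCE ADJOINT LETTER**: `F₂sQC 𝔮s b (base U) (mult a) = QsbQC (V ↦ 𝔮s(e^{iηa}V) − 𝔮s(V)) b (base U)` («F*_{2,j} is not the adjoint of F_{2,j}»
for complex `a` — here it is simply the variation of the adjoint letter, whatever that letter is). [cite: Balaban1985BackgroundPropagators, (3.80) p.406, (3.13) p.393] -/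
theorem F₂sQC_eq_QsbQC_diff (U : CfgY 𝔸 i) (a : AfldY 𝔸 i) :
    F₂sQC i 𝔮s b (.base U) (.mult a) = QsbQC i (fun V => 𝔮s (decY i (.prod V a)) - 𝔮s V) b (.base U) := by
  show QsbQC i 𝔮s b (.prod U a) - QsbQC i 𝔮s b (.base U) = _
  simp only [QsbQC, QsbVQY, decY_base, LinearMap.sub_comp, map_sub, restrictScalars_sub', conj_sub]

/-- ★ the `ℓ²` letter: `F₂QC2 𝔮 b (base U) (mult a) = QbQC2 (V ↦ 𝔮(e^{iηa}V) − 𝔮(V)) b (base U)`. [cite: Balaban1985BackgroundPropagators, (3.80) p.406; Balaban1984PropagatorsII, (2.20) p.226] -/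
theorem F₂QC2_eq_QbQC2_diff (U : CfgY 𝔸 i) (a : AfldY 𝔸 i) :
    F₂QC2 i 𝔮 b (.base U) (.mult a) = QbQC2 i (fun V => 𝔮 (decY i (.prod V a)) - 𝔮 V) b (.base U) := by
  show QbQC2 i 𝔮 b (.prod U a) - QbQC2 i 𝔮 b (.base U) = _
  simp only [QbQC2, QbQY2, decY_base, LinearMap.comp_sub, map_sub, restrictScalars_sub', conj_sub]

/-- ★ the `ℓ²` adjoint letter: `F₂sQC2 𝔮s b (base U) (mult a) = QsbQC2 (V ↦ 𝔮s(e^{iηa}V) − 𝔮s(V)) b (base U)`. [cite: Balaban1985BackgroundPropagators, (3.80) p.406; Balaban1984PropagatorsII, (2.19) p.226] -/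
theorem F₂sQC2_eq_QsbQC2_diff (U : CfgY 𝔸 i) (a : AfldY 𝔸 i) :
    F₂sQC2 i 𝔮s b (.base U) (.mult a) = QsbQC2 i (fun V => 𝔮s (decY i (.prod V a)) - 𝔮s V) b (.base U) := by
  show QsbQC2 i 𝔮s b (.prod U a) - QsbQC2 i 𝔮s b (.base U) = _
  simp only [QsbQC2, QsbQY2, decY_base, LinearMap.sub_comp, map_sub, restrictScalars_sub', conj_sub]

/-! ## §2 ★★ Kernel data of the differences ⟹ block majorants of the (3.80) letters -/

section Letters

variable [Fintype (geo9K i).Site] {Rr : ℝ} {Hp : Prop}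

/-- ★★ **ROW KERNEL OF `𝔮(e^{iηa}U) − 𝔮(U)` ⟹ (3.81) BLOCK MAJORANT OF `F₂`**: if `‖(𝔮(e^{iηa}U)Λ − 𝔮(U)Λ)(κ)‖ ≦ Σ_f k(κ,f)·‖Λ(f)‖` with `k ≧ 0`, rows `≦ C` and support radius `r`
in the labelled blocks, then `F₂QC 𝔮 b (base U) (mult a) ≺ (M₂Σ‖b_j‖)·C·e^{δr}·e^{−δd}` for every `δ ≧ 0` (dag-n06-c's `hasMajorant_QbQC_of_rowKernel` at the difference letter).
[cite: Balaban1985BackgroundPropagators, (3.80)–(3.81) p.406, (3.12)–(3.15) pp.392–393; Balaban1984PropagatorsII, (2.51) p.232] -/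
theorem hasMajorant_F₂QC_of_rowKernel {M₂ : ℝ} (hM₂ : 0 ≤ M₂) (hrepr : ∀ (v : 𝔸) (j : ι), |b.repr v j| ≤ M₂ * ‖v‖) {U : CfgY 𝔸 i} {a : AfldY 𝔸 i}
    (k : IBondY i → FBondY i → ℝ) (hk : ∀ κ f, 0 ≤ k κ f)
    (hrow : ∀ (Λ : FBondY i → 𝔸) (κ : IBondY i), ‖𝔮 (decY i (.prod U a)) Λ κ - 𝔮 U Λ κ‖ ≤ ∑ f, k κ f * ‖Λ f‖)
    {C r : ℝ} (hC : 0 ≤ C) (hsum : ∀ κ, ∑ f, k κ f ≤ C)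
    (hsupp : ∀ κ f, k κ f ≠ 0 →
      (geo9K i).dist (blkC i ιB (B6GlobalChartV1.boxEquiv i.hN (repBondY i κ).src)) (blkC i ιB (B6GlobalChartV1.boxEquiv i.hN f.src)) ≤ r)
    {δ : ℝ} (hδ : 0 ≤ δ) :
    HasMajorant (g := toB6 (geo9K i) Rr Hp) (fun q : (Fin (d + 1) × SiteY i) × ι => blkC i ιB q.1.2) (F₂QC i 𝔮 b (.base U) (.mult a))
      (fun a₁ a₂ => (M₂ * ∑ j, ‖b j‖) * (C * Real.exp (δ * r) * Real.exp (-(δ * (geo9K i).dist a₁ a₂)))) := by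
  rw [F₂QC_eq_QbQC_diff]
  exact hasMajorant_QbQC_of_rowKernel (Rr := Rr) (Hp := Hp) i (fun V => 𝔮 (decY i (.prod V a)) - 𝔮 V) b ιB hM₂ hrepr k hk
    (fun Λ κ => by simpa only [LinearMap.sub_apply, Pi.sub_apply] using hrow Λ κ) hC hsum hsupp hδ

/-- ★★ **COLUMN KERNEL OF `𝔮s(e^{iηa}U) − 𝔮s(U)` ⟹ (3.81) BLOCK MAJORANT OF `F₂*`, BLOCK-RESTRICTED COLUMN MASS**: if `‖(𝔮s(e^{iηa}U)Ψ − 𝔮s(U)Ψ)(f)‖ ≦ Σ_κ k(κ,f)·‖Ψ(κ)‖`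
with `k ≧ 0`, volume-weighted columns over the representatives of one labelled block `≦ C`, support radius `r`, then `F₂sQC 𝔮s b (base U) (mult a) ≺ (M₂Σ‖b_j‖)·C·e^{δr}·e^{−δd}`
(dag-n06-c's `hasMajorant_QsbQC_of_colKernel'` at the difference letter). [cite: Balaban1985BackgroundPropagators, (3.80)–(3.81) p.406, (3.13)–(3.15) pp.392–393; Balaban1984PropagatorsII, (2.51) p.232] -/
theorem hasMajorant_F₂sQC_of_colKernel' {M₂ : ℝ} (hM₂ : 0 ≤ M₂) (hrepr : ∀ (v : 𝔸) (j : ι), |b.repr v j| ≤ M₂ * ‖v‖) {U : CfgY 𝔸 i} {a : AfldY 𝔸 i}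
    (k : IBondY i → FBondY i → ℝ) (hk : ∀ κ f, 0 ≤ k κ f)
    (hcol : ∀ (Ψ : IBondY i → 𝔸) (f : FBondY i), ‖𝔮s (decY i (.prod U a)) Ψ f - 𝔮s U Ψ f‖ ≤ ∑ κ, k κ f * ‖Ψ κ‖)
    {C r : ℝ} (hC : 0 ≤ C) (hsumV : ∀ (f : FBondY i) (y : IBondY i), ∑ κ, indB i ιB y (repBondY i κ) * (volY i κ * k κ f) ≤ C)
    (hsupp : ∀ κ f, k κ f ≠ 0 → (geo9K i).dist (ιB (blkV1 i.hN i.D (repBondY i κ))) (ιB (blkV1 i.hN i.D f)) ≤ r)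
    {δ : ℝ} (hδ : 0 ≤ δ) :
    HasMajorant (g := toB6 (geo9K i) Rr Hp) (fun q : (Fin (d + 1) × SiteY i) × ι => blkC i ιB q.1.2) (F₂sQC i 𝔮s b (.base U) (.mult a))
      (fun a₁ a₂ => (M₂ * ∑ j, ‖b j‖) * (C * Real.exp (δ * r) * Real.exp (-(δ * (geo9K i).dist a₁ a₂)))) := by
  rw [F₂sQC_eq_QsbQC_diff]
  exact hasMajorant_QsbQC_of_colKernel' (Rr := Rr) (Hp := Hp) i (fun V => 𝔮s (decY i (.prod V a)) - 𝔮s V) b ιB hM₂ hrepr k hk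
    (fun Ψ f => by simpa only [LinearMap.sub_apply, Pi.sub_apply] using hcol Ψ f) hC hsumV hsupp hδ

variable [DecidableEq (geo9K i).Site]

/-- ★★ **ROW KERNEL ⟹ (3.81) BLOCK-`ℓ²` MAJORANT OF `F₂2`** (Schur data: rows `≦ R`, block-restricted volume-weighted columns `≦ Cv`, radius `r`): `F₂QC2 𝔮 b (base U) (mult a) ≺₂
(√|ι|·M₂Σ‖b_j‖)·√(R·Cv)·e^{δr}·e^{−δd}` (dag-n06-c's `hasL2Majorant_QbQC2_of_rowKernel` at the difference letter).
[cite: Balaban1985BackgroundPropagators, (3.80)–(3.81) p.406, (3.15) p.393; Balaban1984PropagatorsII, Prop. 2.6 (2.140) p.247, (2.51) p.232] -/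
theorem hasL2Majorant_F₂QC2_of_rowKernel {M₂ : ℝ} (hM₂ : 0 ≤ M₂) (hrepr : ∀ (v : 𝔸) (j : ι), |b.repr v j| ≤ M₂ * ‖v‖) {U : CfgY 𝔸 i} {a : AfldY 𝔸 i}
    (k : IBondY i → FBondY i → ℝ) (hk : ∀ κ f, 0 ≤ k κ f)
    (hrow : ∀ (Λ : FBondY i → 𝔸) (κ : IBondY i), ‖𝔮 (decY i (.prod U a)) Λ κ - 𝔮 U Λ κ‖ ≤ ∑ f, k κ f * ‖Λ f‖)
    {R Cv r : ℝ} (hR : 0 ≤ R) (hCv : 0 ≤ Cv) (hsum : ∀ κ, ∑ f, k κ f ≤ R)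
    (hcolV : ∀ (f : FBondY i) (y : IBondY i), ∑ κ, indB i ιB y (repBondY i κ) * (volY i κ * k κ f) ≤ Cv)
    (hsupp : ∀ κ f, k κ f ≠ 0 → (geo9K i).dist (ιB (blkV1 i.hN i.D (repBondY i κ))) (ιB (blkV1 i.hN i.D f)) ≤ r)
    {δ : ℝ} (hδ : 0 ≤ δ) :
    HasL2Majorant (g := toB6 (geo9K i) Rr Hp) (fun q : (Fin (d + 1) × SiteY i) × ι => blkC i ιB q.1.2) (F₂QC2 i 𝔮 b (.base U) (.mult a))
      (fun a₁ a₂ => (Real.sqrt (Fintype.card ι) * M₂ * ∑ j, ‖b j‖) * (1 * Real.sqrt (R * Cv) *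
        (Real.exp (δ * r) * Real.exp (-(δ * (geo9K i).dist a₁ a₂))))) := by
  rw [F₂QC2_eq_QbQC2_diff]
  exact hasL2Majorant_QbQC2_of_rowKernel (Rr := Rr) (Hp := Hp) i (fun V => 𝔮 (decY i (.prod V a)) - 𝔮 V) b ιB hM₂ hrepr k hk
    (fun Λ κ => by simpa only [LinearMap.sub_apply, Pi.sub_apply] using hrow Λ κ) hR hCv hsum hcolV hsupp hδ

/-- ★★ **COLUMN KERNEL ⟹ (3.81) BLOCK-`ℓ²` MAJORANT OF `F₂*2`** (dag-n06-c's `hasL2Majorant_QsbQC2_of_colKernel` at the difference adjoint letter).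
[cite: Balaban1985BackgroundPropagators, (3.80)–(3.81) p.406, (3.15) p.393; Balaban1984PropagatorsII, Prop. 2.6 (2.140) p.247, (2.51) p.232] -/
theorem hasL2Majorant_F₂sQC2_of_colKernel {M₂ : ℝ} (hM₂ : 0 ≤ M₂) (hrepr : ∀ (v : 𝔸) (j : ι), |b.repr v j| ≤ M₂ * ‖v‖) {U : CfgY 𝔸 i} {a : AfldY 𝔸 i}
    (k : IBondY i → FBondY i → ℝ) (hk : ∀ κ f, 0 ≤ k κ f)
    (hcol : ∀ (Ψ : IBondY i → 𝔸) (f : FBondY i), ‖𝔮s (decY i (.prod U a)) Ψ f - 𝔮s U Ψ f‖ ≤ ∑ κ, k κ f * ‖Ψ κ‖)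
    {R Cv r : ℝ} (hR : 0 ≤ R) (hCv : 0 ≤ Cv) (hsum : ∀ κ, ∑ f, k κ f ≤ R)
    (hcolV : ∀ (f : FBondY i) (y : IBondY i), ∑ κ, indB i ιB y (repBondY i κ) * (volY i κ * k κ f) ≤ Cv)
    (hsupp : ∀ κ f, k κ f ≠ 0 → (geo9K i).dist (ιB (blkV1 i.hN i.D (repBondY i κ))) (ιB (blkV1 i.hN i.D f)) ≤ r)
    {δ : ℝ} (hδ : 0 ≤ δ) :
    HasL2Majorant (g := toB6 (geo9K i) Rr Hp) (fun q : (Fin (d + 1) × SiteY i) × ι => blkC i ιB q.1.2) (F₂sQC2 i 𝔮s b (.base U) (.mult a))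
      (fun a₁ a₂ => (Real.sqrt (Fintype.card ι) * M₂ * ∑ j, ‖b j‖) * (1 * Real.sqrt (R * Cv) *
        (Real.exp (δ * r) * Real.exp (-(δ * (geo9K i).dist a₁ a₂))))) := by
  rw [F₂sQC2_eq_QsbQC2_diff]
  exact hasL2Majorant_QsbQC2_of_colKernel (Rr := Rr) (Hp := Hp) i (fun V => 𝔮s (decY i (.prod V a)) - 𝔮s V) b ιB hM₂ hrepr k hk
    (fun Ψ f => by simpa only [LinearMap.sub_apply, Pi.sub_apply] using hcol Ψ f) hR hCv hsum hcolV hsupp hδ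

end Letters

/-! ## §3 ★★ The member-level packaging: kernel data on the instance's class `C37` ⟹ the K2-G binders `hQ80` ∕ `hQL280` verbatim -/

section Members

open Literature.MathematicalPhysics.QuantumFieldTheory.Balaban1983to89.B9SectBCodedClassR (RegExtraY bg9YC)

variable {Mstar : ℕ} (P : RegExtraY d ℓ hd hL b₀ b₁ Mstar 𝔸) {J : Type} (f : J → MemberY d ℓ hd hL b₀ b₁ Mstar)
  [∀ x : MemberY d ℓ hd hL b₀ b₁ Mstar, Fintype (geo9Y x).Site] [instDS : ∀ x : MemberY d ℓ hd hL b₀ b₁ Mstar, DecidableEq (geo9Y x).Site]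
  (𝔮f : ∀ j : J, CfgY 𝔸 (f j).toKIdx → ((FBondY (f j).toKIdx → 𝔸) →ₗ[ℂ] (IBondY (f j).toKIdx → 𝔸)))
  (𝔮sf : ∀ j : J, CfgY 𝔸 (f j).toKIdx → ((IBondY (f j).toKIdx → 𝔸) →ₗ[ℂ] (FBondY (f j).toKIdx → 𝔸)))
  (ιBf : ∀ j : J, BlkY (f j).toKIdx → IBondY (f j).toKIdx)
  (C37 : ∀ j : J, ℝ → CfgY 𝔸 (f j).toKIdx → AfldY 𝔸 (f j).toKIdx → Prop)

omit instDS in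
/-- ★★ **THE K2-G VARIATION LAW `hQ80` FROM KERNEL DATA ON THE INSTANCE's CLASS**: if, for every member `j` and every pair `(U, a)` of the class `C37 j β′ U a` (`β′ > 0`), the
differences `𝔮 j (e^{iηa}U) − 𝔮 j U` and `𝔮s j (e^{iηa}U) − 𝔮s j U` are majorised by kernels `kQ j β′ U a ∕ kQs j β′ U a ≧ 0` (they may depend on `β′`) with row mass resp. block-restricted volume-weighted column mass
`≦ C·β′` and support radius `r ≧ 0` in the labelled blocks, then the binder `hQ80` of `sectBStepUParGQ_of_members` holds VERBATIM with `cF := (M₂Σ‖b_j‖)·C·e^{r}`.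
[cite: Balaban1985BackgroundPropagators, (3.80)–(3.81) p.406, Thm 3.4 p.400; Balaban1984PropagatorsII, (2.51) p.232] -/
theorem hQ80_of_kernels {M₂ : ℝ} (hM₂ : 0 ≤ M₂) (hrepr : ∀ (v : 𝔸) (j : ι), |b.repr v j| ≤ M₂ * ‖v‖)
    {C r : ℝ} (hC : 0 ≤ C) (hr : 0 ≤ r)
    (kQ kQs : ∀ j : J, ℝ → CfgY 𝔸 (f j).toKIdx → AfldY 𝔸 (f j).toKIdx → IBondY (f j).toKIdx → FBondY (f j).toKIdx → ℝ)
    (hker : ∀ j (β' : ℝ) (U : CfgY 𝔸 (f j).toKIdx) (a : AfldY 𝔸 (f j).toKIdx), 0 < β' → C37 j β' U a →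
      (∀ κ f', 0 ≤ kQ j β' U a κ f') ∧
        (∀ (Λ : FBondY (f j).toKIdx → 𝔸) κ, ‖𝔮f j (decY (f j).toKIdx (.prod U a)) Λ κ - 𝔮f j U Λ κ‖ ≤ ∑ f', kQ j β' U a κ f' * ‖Λ f'‖) ∧
        (∀ κ, ∑ f', kQ j β' U a κ f' ≤ C * β') ∧
        (∀ κ f', kQ j β' U a κ f' ≠ 0 → (geo9K (f j).toKIdx).dist (blkC (f j).toKIdx (ιBf j) (B6GlobalChartV1.boxEquiv (f j).toKIdx.hN (repBondY (f j).toKIdx κ).src))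
          (blkC (f j).toKIdx (ιBf j) (B6GlobalChartV1.boxEquiv (f j).toKIdx.hN f'.src)) ≤ r) ∧
      (∀ κ f', 0 ≤ kQs j β' U a κ f') ∧
        (∀ (Ψ : IBondY (f j).toKIdx → 𝔸) f', ‖𝔮sf j (decY (f j).toKIdx (.prod U a)) Ψ f' - 𝔮sf j U Ψ f'‖ ≤ ∑ κ, kQs j β' U a κ f' * ‖Ψ κ‖) ∧
        (∀ f' (y : IBondY (f j).toKIdx), ∑ κ, indB (f j).toKIdx (ιBf j) y (repBondY (f j).toKIdx κ) * (volY (f j).toKIdx κ * kQs j β' U a κ f') ≤ C * β') ∧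
        (∀ κ f', kQs j β' U a κ f' ≠ 0 → (geo9K (f j).toKIdx).dist (ιBf j (blkV1 (f j).toKIdx.hN (f j).toKIdx.D (repBondY (f j).toKIdx κ)))
          (ιBf j (blkV1 (f j).toKIdx.hN (f j).toKIdx.D f')) ≤ r)) :
    ∀ j (β' : ℝ) (U : CfgY 𝔸 (f j).toKIdx) (a : AfldY 𝔸 (f j).toKIdx), 0 < β' → C37 j β' U a → ∀ δ : ℝ, 0 < δ → δ ≤ 1 →
      HasMajorant (g := toB6 (geo9Y (f j)) 0 True) (fun q : (Fin (d + 1) × SiteY (f j).toKIdx) × ι => blkC (f j).toKIdx (ιBf j) q.1.2)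
          (F₂QC (f j).toKIdx (𝔮f j) b (.base U) (.mult a)) (fun a₁ a₂ => ((M₂ * ∑ j, ‖b j‖) * C * Real.exp r) * β' * Real.exp (-(δ * (geo9Y (f j)).dist a₁ a₂))) ∧
        HasMajorant (g := toB6 (geo9Y (f j)) 0 True) (fun q : (Fin (d + 1) × SiteY (f j).toKIdx) × ι => blkC (f j).toKIdx (ιBf j) q.1.2)
          (F₂sQC (f j).toKIdx (𝔮sf j) b (.base U) (.mult a)) (fun a₁ a₂ => ((M₂ * ∑ j, ‖b j‖) * C * Real.exp r) * β' * Real.exp (-(δ * (geo9Y (f j)).dist a₁ a₂))) := by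
  intro j β' U a hβ' hCl δ hδ hδ1
  letI : Fintype (geo9K (f j).toKIdx).Site := ‹∀ x : MemberY d ℓ hd hL b₀ b₁ Mstar, Fintype (geo9Y x).Site› (f j)
  obtain ⟨hk0, hrow, hsum, hsupp, hks0, hcol, hsumV, hsupps⟩ := hker j β' U a hβ' hCl
  have hMS : 0 ≤ M₂ * ∑ j, ‖b j‖ := mul_nonneg hM₂ (Finset.sum_nonneg fun j _ => norm_nonneg _)
  have hCβ : 0 ≤ C * β' := mul_nonneg hC hβ'.le
  have her : Real.exp (δ * r) ≤ Real.exp r := Real.exp_le_exp.2 (by nlinarith)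
  have hup : ∀ a₁ a₂ : (geo9K (f j).toKIdx).Site,
      (M₂ * ∑ j, ‖b j‖) * (C * β' * Real.exp (δ * r) * Real.exp (-(δ * (geo9K (f j).toKIdx).dist a₁ a₂))) ≤
        ((M₂ * ∑ j, ‖b j‖) * C * Real.exp r) * β' * Real.exp (-(δ * (geo9K (f j).toKIdx).dist a₁ a₂)) := fun a₁ a₂ => by
    have h0 : 0 ≤ Real.exp (-(δ * (geo9K (f j).toKIdx).dist a₁ a₂)) := (Real.exp_pos _).le
    calc (M₂ * ∑ j, ‖b j‖) * (C * β' * Real.exp (δ * r) * Real.exp (-(δ * (geo9K (f j).toKIdx).dist a₁ a₂)))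
        = (M₂ * ∑ j, ‖b j‖) * C * β' * Real.exp (δ * r) * Real.exp (-(δ * (geo9K (f j).toKIdx).dist a₁ a₂)) := by ring
      _ ≤ (M₂ * ∑ j, ‖b j‖) * C * β' * Real.exp r * Real.exp (-(δ * (geo9K (f j).toKIdx).dist a₁ a₂)) := by gcongr
      _ = _ := by ring
  exact ⟨hasMajorant_mono _ (hasMajorant_F₂QC_of_rowKernel (Rr := 0) (Hp := True) (f j).toKIdx (𝔮f j) b (ιBf j) hM₂ hrepr (kQ j β' U a) hk0 hrow hCβ hsum hsupp hδ.le)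
      hup,
    hasMajorant_mono _ (hasMajorant_F₂sQC_of_colKernel' (Rr := 0) (Hp := True) (f j).toKIdx (𝔮sf j) b (ιBf j) hM₂ hrepr (kQs j β' U a) hks0 hcol hCβ hsumV hsupps hδ.le)
      hup⟩

/-- ★★ **THE K2-G BLOCK-`ℓ²` VARIATION LAW `hQL280` FROM KERNEL DATA ON THE INSTANCE's CLASS**: the same kernel data (rows AND block-restricted volume-weighted columns of
BOTH kernels `≦ C·β′`) give the binder `hQL280` of `sectBStepUParGQ_of_members` VERBATIM with `cF2 := (√|ι|·M₂Σ‖b_j‖)·C·e^{r}` (Schur: `√(Cβ′·Cβ′) = Cβ′`).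
[cite: Balaban1985BackgroundPropagators, (3.80)–(3.81) p.406, (3.46) p.398; Balaban1984PropagatorsII, Prop. 2.6 (2.140) p.247, (2.51) p.232] -/
theorem hQL280_of_kernels {M₂ : ℝ} (hM₂ : 0 ≤ M₂) (hrepr : ∀ (v : 𝔸) (j : ι), |b.repr v j| ≤ M₂ * ‖v‖)
    {C r : ℝ} (hC : 0 ≤ C) (hr : 0 ≤ r)
    (kQ kQs : ∀ j : J, ℝ → CfgY 𝔸 (f j).toKIdx → AfldY 𝔸 (f j).toKIdx → IBondY (f j).toKIdx → FBondY (f j).toKIdx → ℝ)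
    (hker : ∀ j (β' : ℝ) (U : CfgY 𝔸 (f j).toKIdx) (a : AfldY 𝔸 (f j).toKIdx), 0 < β' → C37 j β' U a →
      (∀ κ f', 0 ≤ kQ j β' U a κ f') ∧
        (∀ (Λ : FBondY (f j).toKIdx → 𝔸) κ, ‖𝔮f j (decY (f j).toKIdx (.prod U a)) Λ κ - 𝔮f j U Λ κ‖ ≤ ∑ f', kQ j β' U a κ f' * ‖Λ f'‖) ∧
        (∀ κ, ∑ f', kQ j β' U a κ f' ≤ C * β') ∧
        (∀ f' (y : IBondY (f j).toKIdx), ∑ κ, indB (f j).toKIdx (ιBf j) y (repBondY (f j).toKIdx κ) * (volY (f j).toKIdx κ * kQ j β' U a κ f') ≤ C * β') ∧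
        (∀ κ f', kQ j β' U a κ f' ≠ 0 → (geo9K (f j).toKIdx).dist (ιBf j (blkV1 (f j).toKIdx.hN (f j).toKIdx.D (repBondY (f j).toKIdx κ)))
          (ιBf j (blkV1 (f j).toKIdx.hN (f j).toKIdx.D f')) ≤ r) ∧
      (∀ κ f', 0 ≤ kQs j β' U a κ f') ∧
        (∀ (Ψ : IBondY (f j).toKIdx → 𝔸) f', ‖𝔮sf j (decY (f j).toKIdx (.prod U a)) Ψ f' - 𝔮sf j U Ψ f'‖ ≤ ∑ κ, kQs j β' U a κ f' * ‖Ψ κ‖) ∧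
        (∀ κ, ∑ f', kQs j β' U a κ f' ≤ C * β') ∧
        (∀ f' (y : IBondY (f j).toKIdx), ∑ κ, indB (f j).toKIdx (ιBf j) y (repBondY (f j).toKIdx κ) * (volY (f j).toKIdx κ * kQs j β' U a κ f') ≤ C * β') ∧
        (∀ κ f', kQs j β' U a κ f' ≠ 0 → (geo9K (f j).toKIdx).dist (ιBf j (blkV1 (f j).toKIdx.hN (f j).toKIdx.D (repBondY (f j).toKIdx κ)))
          (ιBf j (blkV1 (f j).toKIdx.hN (f j).toKIdx.D f')) ≤ r)) :
    ∀ j (β' : ℝ) (U : CfgY 𝔸 (f j).toKIdx) (a : AfldY 𝔸 (f j).toKIdx), 0 < β' → C37 j β' U a → ∀ δ : ℝ, 0 < δ → δ ≤ 1 →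
      HasL2Majorant (g := toB6 (geo9Y (f j)) 0 True) (fun q : (Fin (d + 1) × SiteY (f j).toKIdx) × ι => blkC (f j).toKIdx (ιBf j) q.1.2)
          (F₂QC2 (f j).toKIdx (𝔮f j) b (.base U) (.mult a))
          (fun a₁ a₂ => ((Real.sqrt (Fintype.card ι) * M₂ * ∑ j, ‖b j‖) * C * Real.exp r) * β' * Real.exp (-(δ * (geo9Y (f j)).dist a₁ a₂))) ∧
        HasL2Majorant (g := toB6 (geo9Y (f j)) 0 True) (fun q : (Fin (d + 1) × SiteY (f j).toKIdx) × ι => blkC (f j).toKIdx (ιBf j) q.1.2)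
          (F₂sQC2 (f j).toKIdx (𝔮sf j) b (.base U) (.mult a))
          (fun a₁ a₂ => ((Real.sqrt (Fintype.card ι) * M₂ * ∑ j, ‖b j‖) * C * Real.exp r) * β' * Real.exp (-(δ * (geo9Y (f j)).dist a₁ a₂))) := by
  intro j β' U a hβ' hCl δ hδ hδ1
  letI : Fintype (geo9K (f j).toKIdx).Site := ‹∀ x : MemberY d ℓ hd hL b₀ b₁ Mstar, Fintype (geo9Y x).Site› (f j)
  letI : DecidableEq (geo9K (f j).toKIdx).Site := instDS (f j)
  obtain ⟨hk0, hrow, hsum, hcolV, hsupp, hks0, hcol, hsums, hcolVs, hsupps⟩ := hker j β' U a hβ' hCl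
  have hMS : 0 ≤ Real.sqrt (Fintype.card ι) * M₂ * ∑ j, ‖b j‖ :=
    mul_nonneg (mul_nonneg (Real.sqrt_nonneg _) hM₂) (Finset.sum_nonneg fun j _ => norm_nonneg _)
  have hCβ : 0 ≤ C * β' := mul_nonneg hC hβ'.le
  have hsq : Real.sqrt (C * β' * (C * β')) = C * β' := Real.sqrt_mul_self hCβ
  have her : Real.exp (δ * r) ≤ Real.exp r := Real.exp_le_exp.2 (by nlinarith)
  have hup : ∀ a₁ a₂ : (geo9K (f j).toKIdx).Site,
      (Real.sqrt (Fintype.card ι) * M₂ * ∑ j, ‖b j‖) * (1 * Real.sqrt (C * β' * (C * β')) *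
        (Real.exp (δ * r) * Real.exp (-(δ * (geo9K (f j).toKIdx).dist a₁ a₂)))) ≤
        ((Real.sqrt (Fintype.card ι) * M₂ * ∑ j, ‖b j‖) * C * Real.exp r) * β' * Real.exp (-(δ * (geo9K (f j).toKIdx).dist a₁ a₂)) := fun a₁ a₂ => by
    have h0 : 0 ≤ Real.exp (-(δ * (geo9K (f j).toKIdx).dist a₁ a₂)) := (Real.exp_pos _).le
    rw [hsq]
    calc (Real.sqrt (Fintype.card ι) * M₂ * ∑ j, ‖b j‖) * (1 * (C * β') * (Real.exp (δ * r) * Real.exp (-(δ * (geo9K (f j).toKIdx).dist a₁ a₂))))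
        = (Real.sqrt (Fintype.card ι) * M₂ * ∑ j, ‖b j‖) * C * β' * Real.exp (δ * r) * Real.exp (-(δ * (geo9K (f j).toKIdx).dist a₁ a₂)) := by ring
      _ ≤ (Real.sqrt (Fintype.card ι) * M₂ * ∑ j, ‖b j‖) * C * β' * Real.exp r * Real.exp (-(δ * (geo9K (f j).toKIdx).dist a₁ a₂)) := by gcongr
      _ = _ := by ring
  exact ⟨hasL2Majorant_mono _ (hasL2Majorant_F₂QC2_of_rowKernel (Rr := 0) (Hp := True) (f j).toKIdx (𝔮f j) b (ιBf j) hM₂ hrepr (kQ j β' U a) hk0 hrow hCβ hCβ hsum hcolV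
      hsupp hδ.le) hup,
    hasL2Majorant_mono _ (hasL2Majorant_F₂sQC2_of_colKernel (Rr := 0) (Hp := True) (f j).toKIdx (𝔮sf j) b (ιBf j) hM₂ hrepr (kQs j β' U a) hks0 hcol hCβ hCβ hsums hcolVs
      hsupps hδ.le) hup⟩

end Members

/-! ## §4 ★ The end-block law from r06's nested class (3.37): the level window -/

section Window

/-- ★ **THE LEVEL WINDOW — `hC37A` FROM THE NESTED CLASS (3.37) WITH `cA = L`**: if `a` lies in r06's nested class `Cplx337 … (levV1 i) α₁` over the member's chart («|A′| < α₁(Lʲη)⁻¹ on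
Ω_j, j = 0, …, k»), then on the two end blocks of every index bond `κ` of level `j` — whose fine sites have level `≧ j − 1` ([4] (2.2)–(2.4): «a bond of Λ_j has an end-point in Λ_j», the
other end block may lie one layer out; r03's `lev_ends_bounds`) — `Lʲη·‖a_μ(x)‖ ≦ L·α₁`.  This is print's «|A| < α₁(Lʲη)⁻¹ on Bʲ(Λ_j)» (p. 406) made honest across the layer boundary: the
constant «depending on d and L». [cite: Balaban1985BackgroundPropagators, (3.37) p.396, p.406 (before (3.79)); Balaban1984PropagatorsII, (2.2)–(2.4) p.224] -/
theorem endBlock_small_of_cplx337 (i : KIdx d ℓ hd hL b₀ b₁) {U : CfgY 𝔸 i} {α₁ : ℝ} {a : AfldY 𝔸 i}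
    (h37 : Cplx337 (shiftsV1 (PV d ℓ i.m i.K hd hL)) U (kGeo i).eta (kGeo i).L (levV1 i) α₁ a)
    (κ : IBondY i) (μ : Fin (d + 1)) (x : Site (PV d ℓ i.m i.K hd hL) 0)
    (hx : iterBlockOf (κ.1.1 : ℕ) x = κ.1.2.src ∨ iterBlockOf (κ.1.1 : ℕ) x = κ.1.2.tgt) :
    (((ℓ + 1 : ℕ) : ℝ)) ^ (κ.1.1 : ℕ) * (kGeo i).eta * ‖a μ x‖ ≤ (((ℓ + 1 : ℕ) : ℝ)) * α₁ := by
  have hη : 0 < (kGeo i).eta := geo9K_eta_pos i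
  have hL1 : (1 : ℝ) ≤ (((ℓ + 1 : ℕ) : ℝ)) := by exact_mod_cast Nat.succ_le_succ (Nat.zero_le ℓ)
  have hL0 : (0 : ℝ) < (((ℓ + 1 : ℕ) : ℝ)) := by positivity
  set j : ℕ := (κ.1.1 : ℕ) with hj
  -- the site lies in `Ω_{j−1}`
  have hlev : j - 1 ≤ levV1 i x := (lev_ends_bounds i.hN i.D i.hk (one_le_k i) (two_le_RMh i) κ hx).1
  have hOm : OnOmega (levV1 i) (j - 1) x := hlev
  have hb := h37.1 (j - 1) μ x hOm
  -- `‖a‖ < α₁·(L^{j−1}η)⁻¹`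
  have hsc : scaleLen (kGeo i).L (kGeo i).eta (j - 1) = (((ℓ + 1 : ℕ) : ℝ)) ^ (j - 1) * (kGeo i).eta := rfl
  rw [hsc] at hb
  have hpos : 0 < (((ℓ + 1 : ℕ) : ℝ)) ^ (j - 1) * (kGeo i).eta := by positivity
  have hb' : (((ℓ + 1 : ℕ) : ℝ)) ^ (j - 1) * (kGeo i).eta * ‖a μ x‖ ≤ α₁ := by
    have := (lt_mul_inv_iff₀ hpos).1 hb   -- `‖a‖ < α₁ * s⁻¹ ↔ ‖a‖ * s < α₁`
    nlinarith [this]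
  -- `L^j ≤ L·L^{j−1}`
  have hpow : (((ℓ + 1 : ℕ) : ℝ)) ^ j ≤ (((ℓ + 1 : ℕ) : ℝ)) * (((ℓ + 1 : ℕ) : ℝ)) ^ (j - 1) := by
    rcases Nat.eq_zero_or_pos j with h0 | hp
    · rw [h0, pow_zero]; simp
    · rw [← pow_succ', Nat.sub_add_cancel hp]
  calc (((ℓ + 1 : ℕ) : ℝ)) ^ j * (kGeo i).eta * ‖a μ x‖
      ≤ ((((ℓ + 1 : ℕ) : ℝ)) * (((ℓ + 1 : ℕ) : ℝ)) ^ (j - 1)) * (kGeo i).eta * ‖a μ x‖ := by gcongr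
    _ = (((ℓ + 1 : ℕ) : ℝ)) * ((((ℓ + 1 : ℕ) : ℝ)) ^ (j - 1) * (kGeo i).eta * ‖a μ x‖) := by ring
    _ ≤ (((ℓ + 1 : ℕ) : ℝ)) * α₁ := mul_le_mul_of_nonneg_left hb' hL0.le

end Window

end Literature.MathematicalPhysics.QuantumFieldTheory.Balaban1983to89.B9SectBQVarLawsOfKernelY

end
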